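import Mathlib.RingTheory.Polynomial.Hermite.Gaussian
import Mathlib.Analysis.SpecialFunctions.Gaussian.GaussianIntegral
import Mathlib.MeasureTheory.Integral.IntegralEqImproper
import Mathlib.Analysis.Calculus.Deriv.Polynomial
import HarnessLib

/-!
# Orthogonality of the Hermite polynomials under the Gaussian weight: `∫_ℝ He_m He_n e^{−x²/2} dx = √(2π) · n! · [m = n]`

HONEST FRAMING: exact (Metropolis-corrected) sampling algorithms for lattice gauge theory;
figures of merit are autocorrelation/cost numbers at stated couplings and volumes; no
continuum-physics claim.

Venture `LatticeQCDFlow` (cell pub-lqcd), sub-topic `Scoring`; FANOUT row 5 (`s0-sun-a`), GEN-20.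
NEW WORK of the cell (placement rule): the one analytic input of Mehta's integral
`∫_{ℝ^N} e^{−|φ|²/2} Π_{j<k}(φ_j − φ_k)² dφ = (2π)^{N/2} Π_{j=1}^{N} j!` (sibling file `MehtaIntegral`), which closes the
constant in GEN-20's weak-coupling law of the `U(N)` one-plaquette partition function (`BesselToeplitzLaplace`).
Mathlib has the probabilists' Hermite polynomials `Polynomial.hermite n` with the Rodrigues formula
`deriv^[n] e^{−x²/2} = (−1)^n He_n(x) e^{−x²/2}` (`Polynomial.deriv_gaussian_eq_hermite_mul_gaussian`), monicity and
degree; it does not have their orthogonality.  Here, by `n` integrations by parts on `(−∞, ∞)`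
(`MeasureTheory.integral_mul_deriv_eq_deriv_mul`, boundary terms killed by integrability of polynomial × Gaussian
and of its derivative):

* §1 `integrable_pow_mul_gaussian_half`, **`integrable_polynomial_mul_gaussian`** (`p(x) e^{−x²/2}` is integrable for every
  real polynomial `p`), `hasDerivAt_polynomial_mul_gaussian`, `tendsto_polynomial_mul_gaussian_atTop/atBot` (`→ 0`);
* §2 `iteratedDeriv_gaussian_eq` (the Rodrigues formula as a real polynomial), **`integral_polynomial_mul_iteratedDeriv_gaussian`**
  (`∫ p · (e^{−x²/2})^{(n)} = (−1)^n ∫ p^{(n)} e^{−x²/2}`);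
* §3 **`integral_polynomial_mul_hermite_gaussian`** (`∫ p He_n e^{−x²/2} = ∫ p^{(n)} e^{−x²/2}`),
  `iterate_derivative_eq_C_of_natDegree_eq` (`p^{(n)} = n! · lc(p)` for `deg p = n`), `integral_gaussian_half` (`∫ e^{−x²/2} = √(2π)`),
  **`integral_hermite_mul_hermite_gaussian_of_lt`** (`= 0` for `m < n`), **`integral_hermite_sq_gaussian`** (`= √(2π) n!`),
  **`integral_hermite_mul_hermite_gaussian`** (the Gram matrix `√(2π) n! δ_{mn}`).

No `def`, nothing cited as a fact, 0 sorry.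
-/

noncomputable section

open Real MeasureTheory Filter Topology Polynomial

namespace Summit.Ventures.LatticeQCDFlow.Scoring

/-! ### 1. Polynomial times Gaussian: integrability and decay -/

/-- `x^k e^{−x²/2}` is integrable on `ℝ`. -/
theorem integrable_pow_mul_gaussian_half (k : ℕ) :
    Integrable (fun x : ℝ => x ^ k * Real.exp (-(x ^ 2 / 2))) := by
  have h := integrable_rpow_mul_exp_neg_mul_sq (b := 1 / 2) (by norm_num) (s := k)
    (by have : (0 : ℝ) ≤ k := Nat.cast_nonneg k; linarith)
  refine h.congr (Eventually.of_forall fun x => ?_)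
  show x ^ (k : ℝ) * Real.exp (-(1 / 2) * x ^ 2) = x ^ k * Real.exp (-(x ^ 2 / 2))
  rw [Real.rpow_natCast]
  congr 2
  ring

/-- **`p(x) e^{−x²/2}` is integrable on `ℝ`** for every real polynomial `p`. -/
theorem integrable_polynomial_mul_gaussian (p : ℝ[X]) :
    Integrable (fun x : ℝ => p.eval x * Real.exp (-(x ^ 2 / 2))) := by
  have h : (fun x : ℝ => p.eval x * Real.exp (-(x ^ 2 / 2)))
      = fun x => ∑ i ∈ Finset.range (p.natDegree + 1), p.coeff i * (x ^ i * Real.exp (-(x ^ 2 / 2))) := by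
    funext x
    rw [Polynomial.eval_eq_sum_range, Finset.sum_mul]
    refine Finset.sum_congr rfl fun i _ => ?_
    ring
  rw [h]
  exact integrable_finsetSum _ fun i _ => (integrable_pow_mul_gaussian_half i).const_mul _

/-- The derivative of `p(x) e^{−x²/2}` is `(p′ − X p)(x) e^{−x²/2}`. -/
theorem hasDerivAt_polynomial_mul_gaussian (p : ℝ[X]) (x : ℝ) :
    HasDerivAt (fun x : ℝ => p.eval x * Real.exp (-(x ^ 2 / 2)))
      ((derivative p - X * p).eval x * Real.exp (-(x ^ 2 / 2))) x := by
  have hg : HasDerivAt (fun x : ℝ => Real.exp (-(x ^ 2 / 2))) (Real.exp (-(x ^ 2 / 2)) * (-x)) x := by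
    have h1 : HasDerivAt (fun x : ℝ => -(x ^ 2 / 2)) (-x) x := by
      have h := ((hasDerivAt_pow 2 x).div_const 2).neg
      have e : -((((2 : ℕ) : ℝ)) * x ^ (2 - 1) / 2) = -x := by norm_num
      rwa [e] at h
    exact h1.exp
  refine ((p.hasDerivAt x).mul hg).congr_deriv ?_
  simp only [eval_sub, eval_mul, eval_X]
  ring

/-- `p(x) e^{−x²/2} → 0` as `x → +∞` (integrable with integrable derivative). -/
theorem tendsto_polynomial_mul_gaussian_atTop (p : ℝ[X]) :
    Tendsto (fun x : ℝ => p.eval x * Real.exp (-(x ^ 2 / 2))) atTop (𝓝 0) :=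
  tendsto_zero_of_hasDerivAt_of_integrableOn_Ioi (a := 0) (fun x _ => hasDerivAt_polynomial_mul_gaussian p x)
    (integrable_polynomial_mul_gaussian _).integrableOn (integrable_polynomial_mul_gaussian p).integrableOn

/-- `p(x) e^{−x²/2} → 0` as `x → −∞`. -/
theorem tendsto_polynomial_mul_gaussian_atBot (p : ℝ[X]) :
    Tendsto (fun x : ℝ => p.eval x * Real.exp (-(x ^ 2 / 2))) atBot (𝓝 0) :=
  tendsto_zero_of_hasDerivAt_of_integrableOn_Iic (a := 0) (fun x _ => hasDerivAt_polynomial_mul_gaussian p x)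
    (integrable_polynomial_mul_gaussian _).integrableOn (integrable_polynomial_mul_gaussian p).integrableOn

/-! ### 2. Integration by parts `n` times against the Gaussian -/

/-- `aeval x (hermite n)` as the evaluation of the real polynomial `(hermite n).map (Int.castRingHom ℝ)`. -/
theorem aeval_hermite_eq_eval_map (n : ℕ) (x : ℝ) :
    aeval x (hermite n) = ((hermite n).map (Int.castRingHom ℝ)).eval x := by
  rw [aeval_def, eval_map, algebraMap_int_eq]

/-- The Rodrigues formula with a real polynomial: `(e^{−x²/2})^{(n)} = ((−1)^n He_n)(x) · e^{−x²/2}`. -/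
theorem iteratedDeriv_gaussian_eq (n : ℕ) :
    deriv^[n] (fun y : ℝ => Real.exp (-(y ^ 2 / 2)))
      = fun x => (C ((-1 : ℝ) ^ n) * (hermite n).map (Int.castRingHom ℝ)).eval x * Real.exp (-(x ^ 2 / 2)) := by
  funext x
  rw [deriv_gaussian_eq_hermite_mul_gaussian, eval_mul, eval_C, aeval_hermite_eq_eval_map]

/-- **`n` integrations by parts**: `∫ p(x) (e^{−x²/2})^{(n)}(x) dx = (−1)^n ∫ p^{(n)}(x) e^{−x²/2} dx` for every real
polynomial `p` (no boundary terms on `(−∞, ∞)`). -/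
theorem integral_polynomial_mul_iteratedDeriv_gaussian (n : ℕ) (p : ℝ[X]) :
    ∫ x : ℝ, p.eval x * deriv^[n] (fun y : ℝ => Real.exp (-(y ^ 2 / 2))) x
      = (-1 : ℝ) ^ n * ∫ x : ℝ, (derivative^[n] p).eval x * Real.exp (-(x ^ 2 / 2)) := by
  induction n generalizing p with
  | zero => simp
  | succ n ih =>
    -- `u = p`, `v = g^{(n)}`, `v' = g^{(n+1)}`
    set q : ℝ[X] := C ((-1 : ℝ) ^ n) * (hermite n).map (Int.castRingHom ℝ) with hq
    have hv : deriv^[n] (fun y : ℝ => Real.exp (-(y ^ 2 / 2))) = fun x => q.eval x * Real.exp (-(x ^ 2 / 2)) :=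
      iteratedDeriv_gaussian_eq n
    have hv' : deriv^[n + 1] (fun y : ℝ => Real.exp (-(y ^ 2 / 2)))
        = fun x => (derivative q - X * q).eval x * Real.exp (-(x ^ 2 / 2)) := by
      rw [Function.iterate_succ_apply', hv]
      funext x
      exact (hasDerivAt_polynomial_mul_gaussian q x).deriv
    have hibp := integral_mul_deriv_eq_deriv_mul (a' := 0) (b' := 0) (u := fun x : ℝ => p.eval x)
      (u' := fun x => (derivative p).eval x)
      (v := deriv^[n] (fun y : ℝ => Real.exp (-(y ^ 2 / 2))))
      (v' := deriv^[n + 1] (fun y : ℝ => Real.exp (-(y ^ 2 / 2))))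
      (fun x _ => p.hasDerivAt x) (fun x _ => by
        rw [hv', hv]; exact hasDerivAt_polynomial_mul_gaussian q x) ?_ ?_ ?_ ?_
    · rw [hibp, sub_self, zero_sub, ih (derivative p), Function.iterate_succ_apply, pow_succ]
      ring
    · -- `u v'` integrable
      have h := integrable_polynomial_mul_gaussian (p * (derivative q - X * q))
      refine h.congr (Eventually.of_forall fun x => ?_)
      simp only [Pi.mul_apply, hv', eval_mul]
      ring
    · have h := integrable_polynomial_mul_gaussian (derivative p * q)
      refine h.congr (Eventually.of_forall fun x => ?_)
      simp only [Pi.mul_apply, hv, eval_mul]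
      ring
    · have h := tendsto_polynomial_mul_gaussian_atBot (p * q)
      refine h.congr fun x => ?_
      simp only [Pi.mul_apply, hv, eval_mul]
      ring
    · have h := tendsto_polynomial_mul_gaussian_atTop (p * q)
      refine h.congr fun x => ?_
      simp only [Pi.mul_apply, hv, eval_mul]
      ring

/-! ### 3. Orthogonality -/

/-- **`∫ p(x) He_n(x) e^{−x²/2} dx = ∫ p^{(n)}(x) e^{−x²/2} dx`** for every real polynomial `p`. -/
theorem integral_polynomial_mul_hermite_gaussian (p : ℝ[X]) (n : ℕ) :
    ∫ x : ℝ, p.eval x * aeval x (hermite n) * Real.exp (-(x ^ 2 / 2))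
      = ∫ x : ℝ, (derivative^[n] p).eval x * Real.exp (-(x ^ 2 / 2)) := by
  have h := integral_polynomial_mul_iteratedDeriv_gaussian n (C ((-1 : ℝ) ^ n) * p)
  have hpt : ∀ x : ℝ, (C ((-1 : ℝ) ^ n) * p).eval x * deriv^[n] (fun y : ℝ => Real.exp (-(y ^ 2 / 2))) x
      = p.eval x * aeval x (hermite n) * Real.exp (-(x ^ 2 / 2)) := by
    intro x
    rw [deriv_gaussian_eq_hermite_mul_gaussian, eval_mul, eval_C]
    have : ((-1 : ℝ) ^ n) * ((-1 : ℝ) ^ n) = 1 := by rw [← mul_pow]; simp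
    linear_combination (p.eval x * aeval x (hermite n) * Real.exp (-(x ^ 2 / 2))) * this
  simp_rw [hpt] at h
  rw [h]
  have hder : derivative^[n] (C ((-1 : ℝ) ^ n) * p) = C ((-1 : ℝ) ^ n) * derivative^[n] p := by
    rw [← smul_eq_C_mul, ← smul_eq_C_mul, Polynomial.iterate_derivative_smul]
  rw [hder, ← integral_const_mul]
  refine integral_congr_ae (Eventually.of_forall fun x => ?_)
  simp only [eval_mul, eval_C]
  have : ((-1 : ℝ) ^ n) * ((-1 : ℝ) ^ n) = 1 := by rw [← mul_pow]; simp
  linear_combination ((derivative^[n] p).eval x * Real.exp (-(x ^ 2 / 2))) * this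

/-- For a polynomial of degree `n`: `p^{(n)} = n! · (leading coefficient)`, a constant. -/
theorem iterate_derivative_eq_C_of_natDegree_eq {p : ℝ[X]} {n : ℕ} (hp : p.natDegree = n) :
    derivative^[n] p = C ((n.factorial : ℝ) * p.coeff n) := by
  have hdeg : (derivative^[n] p).natDegree = 0 := by
    have h := natDegree_iterate_derivative p n
    omega
  rw [eq_C_of_natDegree_eq_zero hdeg, coeff_iterate_derivative, zero_add, Nat.descFactorial_self, nsmul_eq_mul]

/-- `∫ e^{−x²/2} dx = √(2π)`. -/
theorem integral_gaussian_half : ∫ x : ℝ, Real.exp (-(x ^ 2 / 2)) = √(2 * π) := by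
  have h := integral_gaussian (1 / 2)
  have he : (fun x : ℝ => Real.exp (-(1 / 2) * x ^ 2)) = fun x => Real.exp (-(x ^ 2 / 2)) := by
    funext x; congr 1; ring
  rw [he] at h
  rw [h]
  congr 1
  ring

/-- **Orthogonality**: `∫ He_m(x) He_n(x) e^{−x²/2} dx = 0` for `m < n`. -/
theorem integral_hermite_mul_hermite_gaussian_of_lt {m n : ℕ} (h : m < n) :
    ∫ x : ℝ, aeval x (hermite m) * aeval x (hermite n) * Real.exp (-(x ^ 2 / 2)) = 0 := by
  have hmain := integral_polynomial_mul_hermite_gaussian ((hermite m).map (Int.castRingHom ℝ)) n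
  simp_rw [← aeval_hermite_eq_eval_map] at hmain
  rw [hmain]
  have hzero : derivative^[n] ((hermite m).map (Int.castRingHom ℝ)) = 0 :=
    iterate_derivative_eq_zero (by rw [natDegree_map_eq_of_injective Int.cast_injective, natDegree_hermite]; exact h)
  simp [hzero]

/-- **Normalisation**: `∫ He_n(x)² e^{−x²/2} dx = √(2π) · n!`. -/
theorem integral_hermite_sq_gaussian (n : ℕ) :
    ∫ x : ℝ, aeval x (hermite n) * aeval x (hermite n) * Real.exp (-(x ^ 2 / 2)) = √(2 * π) * n.factorial := by
  have hmain := integral_polynomial_mul_hermite_gaussian ((hermite n).map (Int.castRingHom ℝ)) n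
  simp_rw [← aeval_hermite_eq_eval_map] at hmain
  rw [hmain]
  have hdeg : ((hermite n).map (Int.castRingHom ℝ)).natDegree = n := by
    rw [natDegree_map_eq_of_injective Int.cast_injective, natDegree_hermite]
  have hlc : ((hermite n).map (Int.castRingHom ℝ)).coeff n = 1 := by
    rw [coeff_map, coeff_hermite_self]; simp
  rw [iterate_derivative_eq_C_of_natDegree_eq hdeg, hlc, mul_one]
  simp only [eval_C]
  rw [integral_const_mul, integral_gaussian_half, mul_comm]

/-- **The Gram matrix of the Hermite polynomials under `e^{−x²/2} dx`**:
`∫ He_m He_n e^{−x²/2} = √(2π) · n! · [m = n]`. -/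
theorem integral_hermite_mul_hermite_gaussian (m n : ℕ) :
    ∫ x : ℝ, aeval x (hermite m) * aeval x (hermite n) * Real.exp (-(x ^ 2 / 2))
      = if m = n then √(2 * π) * n.factorial else 0 := by
  rcases lt_trichotomy m n with h | rfl | h
  · rw [if_neg h.ne, integral_hermite_mul_hermite_gaussian_of_lt h]
  · rw [if_pos rfl, integral_hermite_sq_gaussian]
  · rw [if_neg h.ne']
    have h' := integral_hermite_mul_hermite_gaussian_of_lt h
    simp_rw [mul_comm (aeval _ (hermite n)) (aeval _ (hermite m))] at h'
    exact h'

end Summit.Ventures.LatticeQCDFlow.Scoring
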